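import Summits.AtomisticToContinuum.Crystallization.Theorems.FrustratedLawDichotomyStrainedPatchHomEntryLeafHTA2QCellB9S1

/-!
# THE FULL `2⁻⁹` BULK CELL `cB065 × wB9A`, part 2: ★★★ the certificate side `htCertSideA2Q pB9A2 QB9 GnB9 JB065 cB065 wB9A = true` AS IS (`t = 0.018`)
# (27623 `(H) HomFloor (1/625)`, hcp half; hand-1 g36 landing hand-1 g35's verified drafts; critic rows 1331 (2a)/(2c) / 1337)

decomp-a2c hand-1 g35/g36.  KERNEL (hand-1 g35 seat probes K1/K3): `restB9A2` (`htCertRestA2`: ball / jac / straddlers / PSD confinement / curvature floor `λ₁ = 0.35` on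
the `2⁻⁹` box / far Jacobians / guards; 80 s), `linB9A2` (`1905560417375 ≤ 1907000000000`), `farB9A2` (`1973085947535 ≤ 1983941366020`) (113 s together); with
`…CellB9S1.qB9_0/1/2`: ★★★ `htCertSideA2Q_B9A2` — the second-order affine certificate side passes on the FULL `2⁻⁹` bulk cell as is.

Kernel facts + assembly; 0 sorry; standard axioms; no definitions.  `--supports stmt-AtomisticToContinuum-27623`.
-/

namespace Summit.AtomisticToContinuum.Crystallization.Theorems.FrustratedLawDichotomyStrainedPatchHomEntryLeafHT

open Literature.Analysis.ValidatedNumerics.Numerics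
open Summit.AtomisticToContinuum.Crystallization.Theorems.FrustratedLawDichotomyStrainedPatchHomCertTree (CertTree treeOK)
open Summit.AtomisticToContinuum.Crystallization.Theorems.FrustratedLawDichotomyStrainedPatchHomEntryTable (muRec)
open Summit.AtomisticToContinuum.Crystallization.Theorems.FrustratedLawDichotomyStrainedPatchHomEntryFitHcpCentred (entryLeafOKHQDCR)
open Summit.AtomisticToContinuum.Crystallization.Theorems.FrustratedLawDichotomyStrainedPatchHomSlopeLJ
open Summit.AtomisticToContinuum.Crystallization.Theorems.FrustratedLawDichotomyStrainedPatchHomSlopeLJAffine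
open Summit.AtomisticToContinuum.Crystallization.Theorems.FrustratedLawDichotomyStrainedPatchHomSlopeLJAffine2Kit

set_option maxRecDepth 100000 in
set_option maxHeartbeats 4000000 in
/-- ★ KERNEL: the non-slope conjuncts of the certificate side at `cB065 × wB9A` (`≈ 80 s`). -/
theorem restB9A2 : htCertRestA2 pB9A2 JB065 cB065 wB9A = true := by
  decide +kernel

set_option maxRecDepth 100000 in
set_option maxHeartbeats 4000000 in
/-- ★ KERNEL: `g₀ + lin + ⌈√ΣQ²⌉ + rem3 + nai = 1905560417375 ≤ GnB9`. -/
theorem linB9A2 : g0LJ cB065 (htScA2F cB065 wB9A JB065 (htNearU cB065 wB9A)) + linLJA cB065 wB9A JB065 (htScA2F cB065 wB9A JB065 (htNearU cB065 wB9A)) + sqrtQ QB9 +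
    rem3LJ cB065 (hullW JB065 wB9A) (htScA2F cB065 wB9A JB065 (htNearU cB065 wB9A)) + naiSLJ cB065 (hullW JB065 wB9A) (htSnA2F cB065 wB9A JB065 (htNearU cB065 wB9A)) ≤ GnB9 := by
  decide +kernel

set_option maxRecDepth 100000 in
set_option maxHeartbeats 4000000 in
/-- KERNEL: `GnB9 + far₁ + far₂ = 1973085947535 ≤ Gs`. -/
theorem farB9A2 : GnB9 + htGsNA cB065 wB9A JB065 (htFar1U cB065 wB9A) + htGsNA cB065 wB9A JB065 (htFar2U cB065 wB9A) ≤ pB9A2.Gs := by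
  decide +kernel

/-- ★★★ **THE SECOND-ORDER AFFINE CERTIFICATE SIDE OF THE `2⁻⁹` BULK CELL HOLDS** (six kernel facts; slack `0.55 %` of `Gs`). [assembly] -/
theorem htCertSideA2Q_B9A2 : htCertSideA2Q pB9A2 QB9 GnB9 JB065 cB065 wB9A = true :=
  htCertSideA2Q_of_parts restB9A2 qB9_0 qB9_1 qB9_2 linB9A2 farB9A2

end Summit.AtomisticToContinuum.Crystallization.Theorems.FrustratedLawDichotomyStrainedPatchHomEntryLeafHT
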